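import Summits.BirchSwinnertonDyer.BirchSwinnertonDyer.Theorems.KimAtThreeDeepLowerOffStratumLevelLoweringMultiStabDepleteCertificate
import Summits.BirchSwinnertonDyer.BirchSwinnertonDyer.Theorems.KimAtThreeDeepLowerOffStratumLevelLoweringDepleteTamagawaRowsCovered
import HarnessLib

/-!
# Route `KimAtThreeKolyvagin` (rung W2), crux `DeepLowerAtThreeOffKatoStratum` (item 19679), registered
# stub `stub_nonAdditive`: the DROP class certificate (★¹⁰ᵃ) and the COVERED capstones — every row of Tamagawa depth `≤ 1`
# under «ordinary if good, (ram) only if `3` is multiplicative»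

Cell `bsd-addord`, seat `bsd-addord-w2-acc2`, gen 8; item `stmt-BirchSwinnertonDyer-19679` (`--supports`, closes
nothing). §1 = gen 7's ★¹⁰ (`…MultiStabDepleteRowsClass.stub_nonAdditive_ram_tamagawaDepthOne_of_drop`) cut before the consumer:
the (LL₁) certificate at the split multiplicative Tamagawa-`3` prime `q ∣ N`, constructed from CLASS data (★¹⁰ᵃ, FIVE named
facts). §2 = the COVERED twins of the (ram) capstones of `…DepleteTamagawaRowsClass`: ★¹⁰ᶜ (DROP class), ★¹⁴ᶜ = ★¹⁰ᶜ ∨ ★¹³ᶜ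
(every depth-`1` row with `3 ∣ ∏c`), ★¹⁵ᶜ (every row of Tamagawa depth `≤ 1`, the `3 ∤ ∏c` rows by gen 0's
`…OffStratumNonAdditiveRows.stub_nonAdditive_covered_of_not_three_dvd_tamagawa`) — gen 2's covered consumer
`…LevelLoweringBridge.stub_nonAdditive_covered_of_plusSymbolLevelLowersOver` asks `Ram W₀ 3` only when `3` is multiplicative,
at the price of the Yan–Zhu binder `hYZ` (PRE-tier print, displayed BY NAME). Gen 8's census (r0, surj3, `9 ∤ N`,
ordinary-if-good, `N < 5·10⁵`): the covered capstone adds the 772 good-ordinary no-(ram) depth-`1` rows (392 (M) + 380 (A))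
to the 81 764 (ram) rows of ★¹⁵. Theorems only; nothing booked; BSD is not proved by any of this.

* §1 ★¹⁰ᵃ `isStabilisedLevelLoweringCongruenceIn_of_drop`.
* §2 ★¹⁰ᶜ `stub_nonAdditive_covered_tamagawaDepthOne_of_drop`, ★¹⁴ᶜ `stub_nonAdditive_covered_tamagawaDepthOne`,
  ★¹⁵ᶜ `stub_nonAdditive_covered_tamagawaDepthLeOne`.
[cite: YanZhu2024MainConjNonCM, Thm. 4.15 (§4.6)] [cite: Skinner2016PacificMC, Thm. C (§1)] [cite: Mazur1978, Cor. 4.1]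
[cite: DarmonDiamondTaylor1995, Thm. 3.15, Lemma 2.7, Thm. 3.1 (e)] [cite: DiamondRibet1997, §4.5 Lemma 4.6]
[cite: Ribet1984ICM, Thm. 4.1] [cite: SilvermanATAEC1994, Cor. IV.9.2 (d), Table 4.1, §IV.10] [cite: Kim2022StructureSelmer, Conj. 1.10 (PDF p. 8)]
-/

set_option autoImplicit false
-- the Theorems namespace of a single-conjunct summit repeats the summit name by design (D-0017)
set_option linter.dupNamespace false

noncomputable section

open scoped MatrixGroups ModularForm Classical NNReal NumberField

open CongruenceSubgroup WeierstrassCurve Literature.NumberTheory.EllipticCurves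
  Literature.NumberTheory.EllipticCurves.ModularForms IsDedekindDomain NumberField Rat.HeightOneSpectrum

namespace Summit.BirchSwinnertonDyer.BirchSwinnertonDyer.Theorems.KimAtThreeDeepLowerOffStratumLevelLoweringMultiStabDepleteClassCovered

open Summit.BirchSwinnertonDyer.BirchSwinnertonDyer.Theorems.KimAtThreeDeepLowerOffStratumLevelLoweringMultiStabDepleteRows
open Summit.BirchSwinnertonDyer.BirchSwinnertonDyer.Theorems.KimAtThreeDeepLowerOffStratumLevelLoweringMultiStabRowsRamClass
  (exists_decomposition_exactlyDividing)
open Summit.BirchSwinnertonDyer.BirchSwinnertonDyer.Theorems.KimAtThreeDeepLowerOffStratumLevelLoweringMultiStabRowsClass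
  (split_and_three_dvd_of_three_dvd_localTamagawaNumber)
open Summit.BirchSwinnertonDyer.BirchSwinnertonDyer.Theorems.KimAtThreeShallowEqDeepOffStratumNonAdditiveRows
  (not_sq_dvd_conductorNorm_of_not_addv)
open Literature.NumberTheory.EllipticCurves.Rank1Residual Literature.NumberTheory.EllipticCurves.Rank1Residual.Typed
  Literature.NumberTheory.EllipticCurves.Skinner2016 Literature.NumberTheory.Automorphic


open Summit.BirchSwinnertonDyer.BirchSwinnertonDyer.Theorems.KimAtThreeDeepLowerOffStratumLevelLoweringMultiStabDepleteRowsClass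
  (exists_split_prime_of_three_dvd_tamagawaProduct_of_not_dvd_additive exists_dropSet)
open Summit.BirchSwinnertonDyer.BirchSwinnertonDyer.Theorems.KimAtThreeDeepLowerOffStratumLevelLoweringMultiStabDepleteCertificate
open Summit.BirchSwinnertonDyer.BirchSwinnertonDyer.Theorems.KimAtThreeDeepLowerOffStratumLevelLoweringBridge
open Summit.BirchSwinnertonDyer.BirchSwinnertonDyer.Theorems.KimAtThreeDeepLowerOffStratumLevelLoweringRekey
open Summit.BirchSwinnertonDyer.BirchSwinnertonDyer.Theorems.KimAtThreeDeepLowerOffStratumNonAdditiveRows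
  (stub_nonAdditive_covered_of_not_three_dvd_tamagawa)
open Summit.BirchSwinnertonDyer.BirchSwinnertonDyer.Theorems.KimAtThreeDeepLowerOffStratumLevelLoweringDepleteTamagawaRowsCovered
open IsDedekindDomain Rat.HeightOneSpectrum

/-! ### §1 ★¹⁰ᵃ The (LL₁) certificate from class data (Tamagawa `3` at a multiplicative prime) -/

section Certificate

/-- ★¹⁰ᵃ **THE (LL₁) CERTIFICATE FROM CLASS DATA when the Tamagawa `3` sits at a MULTIPLICATIVE prime** — gen 7's ★¹⁰
(`…MultiStabDepleteRowsClass.stub_nonAdditive_ram_tamagawaDepthOne_of_drop`) cut BEFORE the (ram) consumer: tower-surjective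
`W₀` off the additive stratum at `3`, `D₀` at the conductor with `3`-integral plus symbols, `3 ∣ ∏ c_ℓ`, «`3 ∤ c_p` at every
`p² ∣ N`», «`p³ ∤ N` at every additive place with `3 ∣ #Φ_p(𝔽̄_p)`» ⟹ for some `q ∣ N` (the split multiplicative Tamagawa-`3`
prime) and some `π`, `IsStabilisedLevelLoweringCongruenceIn W₀ 3 1 D₀.f q π`. FIVE named facts (`hRk hCE hV hGV hI`); the
construction of `q`, `A`, `D`, `M₁` and the newform is ★¹⁰'s verbatim, then ★⁹ᵃ.
[cite: DarmonDiamondTaylor1995, Thm. 3.15, Lemma 2.7 and Prop. 2.12] [cite: Ribet1990, Thm. 1.1] [cite: ColemanEdixhoven1998, Thm. 2.1]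
[cite: Vatsal1999, §1 (1.6), Thm. (1.13)] [cite: GreenbergVatsal2000, §3 (17)–(19)] [cite: Ribet1984ICM, Thm. 4.1]
[cite: SilvermanATAEC1994, Cor. IV.9.2 (d), Table 4.1, §IV.10, Prop. 10.3 (a)] -/
theorem isStabilisedLevelLoweringCongruenceIn_of_drop
    (hRk : ribet1990_levelLowering_gamma0_newform_at_three_additiveDrop)
    (hCE : colemanEdixhoven1998_heckePolynomial_simpleRoots)
    (hV : vatsal1999_plusSymbol_congruence) (hGV : greenbergVatsal2000_plusSymbol_congruence)
    (hI : ribet1984_iharaLemma) :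
    ∀ (W₀ : WeierstrassCurve ℚ) [W₀.IsElliptic] [W₀.IsGloballyMinimal],
      (∀ n : ℕ, W₀.HasSurjectiveModNGaloisRep (3 ^ n : ℕ)) →
      ∀ {N : ℕ} [NeZero N], N = W₀.conductorNorm ℤ →
      ∀ (D₀ : ModularParametrizationData W₀ N),
        (∀ r : ℚ, ratPlusSymbol D₀.f r ≠ 0 → 0 ≤ padicValRat 3 (ratPlusSymbol D₀.f r)) →
        ¬ (haveI : Fact (Nat.Prime 3) := ⟨Nat.prime_three⟩; Addv W₀ 3) →
        3 ∣ W₀.tamagawaProduct →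
        (∀ (p : ℕ) (hp : p.Prime), p ^ 2 ∣ N → ¬ 3 ∣ (haveI := Fact.mk hp; (W₀.baseChange ℚ_[p]).localTamagawaNumber ℤ_[p])) →
        (∀ v : HeightOneSpectrum ℤ, W₀.HasAdditiveReductionAt v → 3 ∣ (W₀.kodairaSymbolAt v).componentGroupOrder →
          ¬ natGenerator v ^ 3 ∣ N) →
        ∃ (q : ℕ) (π : ZMod 3 →+* IsLocalRing.ResidueField (Valued.integer (PadicAlgCl 3))),
          q ∣ N ∧ IsStabilisedLevelLoweringCongruenceIn W₀ 3 1 D₀.f q π := by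
  intro W₀ _ _ htower N _ hN D₀ hint hnA h3 hKc hK3
  have hsurj : W₀.HasSurjectiveModNGaloisRep 3 := by simpa using htower 1
  have h9 : ¬ 3 ^ 2 ∣ N := hN ▸ not_sq_dvd_conductorNorm_of_not_addv W₀ hnA
  have hf := D₀.isNewformOf
  -- §1: the Tamagawa-`3` prime `q ∥ N` and the dropping set `A`
  obtain ⟨q, hqF, hqN, hqN2, hsplit, hqΔ⟩ :=
    exists_split_prime_of_three_dvd_tamagawaProduct_of_not_dvd_additive W₀ h3 (fun p hp hp2 ↦ hKc p hp (hN ▸ hp2))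
  have hq : q.Prime := hqF.out
  obtain ⟨A, hAsq, hAadd, hAiff, hAdvd⟩ := exists_dropSet W₀
  rw [← hN] at hqN hqN2 hAadd
  haveI : NeZero A := ⟨Squarefree.ne_zero hAsq⟩
  obtain ⟨N₁, hN₁⟩ := hqN
  have hN₁0 : N₁ ≠ 0 := fun h ↦ NeZero.ne N (by rw [hN₁, h, mul_zero])
  have hqN₁ : ¬ q ∣ N₁ := fun h ↦ hqN2 (by rw [pow_two, hN₁]; exact mul_dvd_mul_left q h)
  have hqA : ¬ q ∣ A := fun h ↦ hqN2 (hAadd q hq h)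
  -- every prime of `A` is squared in `N = q N₁`, `q ∤ A`: `p² ∣ N₁`; hence `A ∣ N₁ = A N₂` and the primes of `A` divide `N₂`
  have hAprime : ∀ p : ℕ, p.Prime → p ∣ A → p * p ∣ N₁ := by
    intro p hp hpA
    have hpq : p ≠ q := fun h ↦ hqA (h ▸ hpA)
    have h2 : p * p ∣ q * N₁ := by rw [← hN₁, ← pow_two]; exact hAadd p hp hpA
    exact (Nat.Coprime.mul_left ((Nat.coprime_primes hp hq).mpr hpq) ((Nat.coprime_primes hp hq).mpr hpq)).dvd_of_dvd_mul_left h2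
  obtain ⟨N₂, hN₂⟩ : A ∣ N₁ := hAdvd N₁ fun p hp hpA ↦ (dvd_mul_right p p).trans (hAprime p hp hpA)
  have hN₂0 : N₂ ≠ 0 := fun h ↦ hN₁0 (by rw [hN₂, h, mul_zero])
  have hAN₂ : ∀ p : ℕ, p.Prime → p ∣ A → p ∣ N₂ := by
    intro p hp hpA
    obtain ⟨A', hA'⟩ := hpA
    have hpA' : ¬ p ∣ A' := fun h ↦ by
      have : p * p ∣ A := by rw [hA']; exact mul_dvd_mul_left p h
      exact hp.ne_one (Nat.isUnit_iff.mp (hAsq p this))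
    have h2 : p * p ∣ p * (A' * N₂) := by rw [← mul_assoc, ← hA', ← hN₂]; exact hAprime p hp ⟨A', hA'⟩
    have h3 : p ∣ A' * N₂ := Nat.dvd_of_mul_dvd_mul_left hp.pos h2
    exact ((Nat.Prime.coprime_iff_not_dvd hp).mpr hpA').dvd_of_dvd_mul_left h3
  -- §2 of ★⁸: `N₂ = M₁·D`, `D` = the primes `r ∥ N` outside `A`, `q` with `3 ∣ ord_r Δ`
  obtain ⟨M₁, D, hMD, hDsq, hDM₁, hDP, hM₁P⟩ :=
    exists_decomposition_exactlyDividing hN₂0 (fun r ↦ (3 : ℤ) ∣ padicValRat r W₀.Δ ∧ ¬ r ^ 2 ∣ N)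
  haveI : NeZero M₁ := ⟨fun h ↦ hN₂0 (by rw [← hMD, h, zero_mul])⟩
  have hNeq : M₁ * D * A * q = N := by rw [hMD, hN₁, hN₂]; ring
  have hqMDA : ¬ q ∣ M₁ * D * A := by rw [hMD, mul_comm, ← hN₂]; exact hqN₁
  have hqM₁ : ¬ q ∣ M₁ := fun h ↦ hqMDA ((h.mul_right D).mul_right A)
  have hqD : ¬ q ∣ D := fun h ↦ hqMDA ((h.mul_left M₁).mul_right A)
  -- `D` is prime to `A` (its primes are `∥ N`), `A`-primes divide `M₁` exactly once
  have hDexact : ∀ p : ℕ, p.Prime → p ∣ D → ¬ p ^ 2 ∣ N := fun p hp hpD ↦ ((hDP p hp hpD).1).2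
  have hAD : Nat.Coprime A D := by
    refine Nat.coprime_of_dvd fun p hp hpA hpD ↦ hDexact p hp hpD ?_
    rw [← hNeq]; exact (hAadd p hp hpA).trans (by rw [hNeq])
  have hA : ∀ ℓ : ℕ, ℓ.Prime → ℓ ∣ A → ℓ ∣ M₁ ∧ ¬ ℓ ^ 2 ∣ M₁ ∧ cuspCoeff D₀.f ℓ = 0 := by
    intro ℓ hℓ hℓA
    haveI : Fact ℓ.Prime := ⟨hℓ⟩
    -- the place `v` of `ℤ` over `ℓ`: additive, with `3 ∣ #Φ_v`
    set v : HeightOneSpectrum ℤ := (primesEquiv (R := ℤ)).symm ⟨ℓ, hℓ⟩ with hvdef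
    have hpv : primesEquiv v = ⟨ℓ, hℓ⟩ := (primesEquiv (R := ℤ)).apply_symm_apply ⟨ℓ, hℓ⟩
    have hgen : natGenerator v = ℓ := congrArg Subtype.val hpv
    have hℓN2 : ℓ ^ 2 ∣ W₀.conductorNorm ℤ := hN ▸ hAadd ℓ hℓ hℓA
    have hadd : W₀.HasAdditiveReductionAt v := by
      rw [← natGenerator_sq_dvd_conductorNorm_iff v W₀, hgen]; exact hℓN2
    have h3Φ : 3 ∣ (W₀.kodairaSymbolAt v).componentGroupOrder := (hAiff v hadd).mpr (hgen ▸ hℓA)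
    have hℓD : ¬ ℓ ∣ D := fun h ↦ hℓ.ne_one (Nat.dvd_one.mp (by
      have hg := Nat.dvd_gcd hℓA h; rwa [Nat.Coprime.gcd_eq_one hAD] at hg))
    -- `ℓ ∣ N₂ = M₁ D`, `ℓ ∤ D` ⟹ `ℓ ∣ M₁`
    have hℓM₁ : ℓ ∣ M₁ :=
      ((Nat.Prime.coprime_iff_not_dvd hℓ).mpr hℓD).dvd_of_dvd_mul_right (by rw [hMD]; exact hAN₂ ℓ hℓ hℓA)
    -- `ℓ² ∣ M₁` would give `ℓ³ ∣ N`
    have hℓ2 : ¬ ℓ ^ 2 ∣ M₁ := by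
      intro h
      refine hK3 v hadd h3Φ ?_
      rw [hgen, ← hNeq, pow_succ]
      exact (mul_dvd_mul h hℓA).trans ⟨D * q, by ring⟩
    refine ⟨hℓM₁, hℓ2, ?_⟩
    -- `a_ℓ(f_E) = 0` at an additive `ℓ`
    have hng : ¬ W₀.HasGoodReductionAtPrime ℓ := fun hg ↦
      not_dvd_conductorNorm_of_hasGoodReductionAtPrime W₀ hg ((dvd_pow_self ℓ two_ne_zero).trans hℓN2)
    have hnm : ¬ W₀.HasMultiplicativeReductionAtPrime ℓ := fun hm ↦ by
      have key : ∀ r : Nat.Primes, primesEquiv v = r →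
          (haveI := Fact.mk r.2; W₀.HasMultiplicativeReductionAtPrime (r : ℕ)) → W₀.HasMultiplicativeReductionAt v := by
        rintro r rfl h'
        exact (hasMultiplicativeReductionAtPrime_primesEquiv_iff_hasMultiplicativeReductionAt W₀ v).mp h'
      exact (key ⟨ℓ, hℓ⟩ hpv hm).not_hasAdditiveReductionAt hadd
    rw [hf.2 ℓ, W₀.LFunction_apply_eq_zero_of_not_good_of_not_mult ℓ hng hnm (dvd_refl ℓ), Int.cast_zero]
  -- the signs `a_p(f) = ±1` at the (multiplicative) primes of `D`
  have hsign : ∀ p : ℕ, p.Prime → p ∣ D → ∃ u : ℤ, u * u = 1 ∧ cuspCoeff D₀.f p = u := by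
    intro p hp hpD
    haveI : Fact p.Prime := ⟨hp⟩
    have hpN : p ∣ W₀.conductorNorm ℤ := by
      rw [← hN, ← hNeq]
      exact ((hpD.mul_left M₁).mul_right A).mul_right q
    have hp2 : ¬ p ^ 2 ∣ W₀.conductorNorm ℤ := hN ▸ hDexact p hp hpD
    rcases hasGoodReductionAtPrime_or_hasMultiplicativeReductionAtPrime_of_not_sq_dvd_conductorNorm (V := W₀) hp2
      with hgood | hmult
    · exact absurd hpN (not_dvd_conductorNorm_of_hasGoodReductionAtPrime W₀ hgood)
    · by_cases hs : W₀.HasSplitMultiplicativeReductionAtPrime p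
      · refine ⟨1, by norm_num, ?_⟩
        rw [hf.2 p, W₀.LFunction_apply_prime_of_hasSplitMultiplicativeReductionAtPrime p hs]
      · refine ⟨-1, by norm_num, ?_⟩
        rw [hf.2 p, W₀.LFunction_apply_prime_of_hasMultiplicativeReductionAtPrime_of_not_split p hmult hs]
  -- the optimal-level newform from the additive-drop fact BY NAME (removed set `D q`, dropping set `A`)
  have hsqDq : Squarefree (D * q) :=
    (Nat.squarefree_mul ((Nat.Prime.coprime_iff_not_dvd hq).mpr hqD).symm).mpr ⟨hDsq, hq.prime.squarefree⟩
  have hcop : Nat.Coprime (D * q) (M₁ * A) := by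
    refine Nat.Coprime.mul_left (Nat.Coprime.mul_right hDM₁ hAD.symm) ?_
    exact (Nat.Prime.coprime_iff_not_dvd hq).mpr fun h ↦ by
      rcases (Nat.Prime.dvd_mul hq).mp h with h | h
      · exact hqM₁ h
      · exact hqA h
  have hDqΔ : ∀ r : ℕ, r.Prime → r ∣ D * q → (3 : ℤ) ∣ padicValRat r W₀.Δ := by
    intro r hr hrDq
    rcases (Nat.Prime.dvd_mul hr).mp hrDq with h | h
    · exact (hDP r hr h).1.1
    · rw [(Nat.prime_dvd_prime_iff_eq hr hq).mp h]; exact hqΔ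
  have hM₁Δ' : ∀ p : ℕ, p.Prime → p ∣ M₁ → ¬ p ^ 2 ∣ N → ¬ (3 : ℤ) ∣ padicValRat p W₀.Δ := by
    intro p hp hpM hp2 h3
    refine hM₁P p hp hpM (fun hp2' ↦ hp2 ?_) ⟨h3, hp2⟩
    rw [← hNeq, hMD]
    exact (hp2'.mul_right A).mul_right q
  have hM₁Δ : ∀ p : ℕ, p.Prime → p ∣ M₁ → ¬ p ^ 2 ∣ N → p ≠ 3 → ¬ (3 : ℤ) ∣ padicValRat p W₀.Δ :=
    fun p hp hpM hp2 _ ↦ hM₁Δ' p hp hpM hp2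
  have h3Δ : 3 ∣ M₁ → ¬ (3 : ℤ) ∣ padicValRat 3 W₀.Δ := fun h3M ↦ hM₁Δ' 3 Nat.prime_three h3M h9
  have hex : ∀ ι : PadicAlgCl 3 ≃+* ℂ, ∃ g : CuspForm (Gamma0 M₁) 2, IsNewform0 g ∧
      (∀ p : ℕ, p.Prime → ¬ p ∣ D * q * A → Valued.v (ι.symm (cuspCoeff D₀.f p - cuspCoeff g p)) < 1) ∧
      (∀ p : ℕ, p.Prime → p ∣ D * q → Valued.v (ι.symm (cuspCoeff g p - cuspCoeff D₀.f p * (p + 1))) < 1) :=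
    fun ι ↦ hRk W₀ hsurj (N := N) (M₁ := M₁) (A := A) (D := D * q) (by rw [← hNeq]; ring) hsqDq hAsq hcop h9 hN hDqΔ hM₁Δ
      h3Δ (fun p hp hpA ↦ hAadd p hp hpA) hAiff D₀ ι
  obtain ⟨π, hLL⟩ := isStabilisedLevelLoweringCongruenceIn_of_exists_levelLoweredNewform_deplete hCE hV hGV hI W₀ htower hN
    D₀ hint hnA hNeq hsplit hqMDA hDsq hDM₁ hAsq hAD hA hsign hex
  exact ⟨q, π, hNeq ▸ dvd_mul_left q _, hLL⟩


end Certificate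

/-! ### §2 The covered class theorems: ★¹⁰ᶜ, ★¹⁴ᶜ, ★¹⁵ᶜ -/

section Covered

/-- ★¹⁰ᶜ **`stub_nonAdditive` on the DROP class (Tamagawa `3` at a multiplicative prime, `3 ∤ c_p` at every `p² ∣ N`, `f = 2`
at the `IV`/`IV*` places) under the COVERED consumer** — stub binders VERBATIM + «ordinary if good» + «(ram) only if `3` is
multiplicative» + `v₃(∏c) ≤ 1` + `3 ∣ ∏c`: ★¹⁰ᵃ's certificate fed to gen 2's
`…LevelLoweringBridge.stub_nonAdditive_covered_of_plusSymbolLevelLowersOver` (ELEVEN named facts, the Yan–Zhu binder PRE-tier).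
[cite: YanZhu2024MainConjNonCM, Thm. 4.15 (§4.6)] [cite: Skinner2016PacificMC, Thm. C (§1)] [cite: DarmonDiamondTaylor1995, Thm. 3.15]
[cite: Ribet1984ICM, Thm. 4.1] [cite: Vatsal1999, §1 (1.6), Thm. (1.13)] [cite: Kim2022StructureSelmer, Conj. 1.10 (PDF p. 8)] -/
theorem stub_nonAdditive_covered_tamagawaDepthOne_of_drop
    (hRk : ribet1990_levelLowering_gamma0_newform_at_three_additiveDrop)
    (hCE : colemanEdixhoven1998_heckePolynomial_simpleRoots)
    (hV : vatsal1999_plusSymbol_congruence) (hGV : greenbergVatsal2000_plusSymbol_congruence)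
    (hI : ribet1984_iharaLemma)
    (hYZ : YanZhu2026.thm415_padicValRat_bsd_rank_le_one)
    (hW20 : Wuthrich2014.lemma20_surjective_threeAdic_of_semistable)
    (hSk : Skinner2016.thmC_padicValRat_bsd_rank_zero)
    (hmod : hasEntireLFunction_rat) (hGZK : rank_eq_analyticRank_of_analyticRank_le_one)
    (hM : mazur_not_dvd_maninConstant_of_odd) :
    ∀ (W₀ : WeierstrassCurve ℚ) [W₀.IsElliptic] [W₀.IsGloballyMinimal],
      (∀ n : ℕ, W₀.HasSurjectiveModNGaloisRep (3 ^ n : ℕ)) → Finite W₀.sha →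
      ∀ {N : ℕ} [NeZero N], N = W₀.conductorNorm ℤ →
      ∀ (D₀ : ModularParametrizationData W₀ N),
        (∀ z ∈ D₀.L.lattice, ∃ w ∈ periodLattice D₀.f, z = D₀.c * w) →
        (∀ (W₂ : WeierstrassCurve ℚ) [W₂.IsElliptic] (D₂ : ModularParametrizationData W₂ N),
          D₂.f = D₀.f → D₀.modularDegree ≤ D₂.modularDegree) →
        (∀ r : ℚ, ratPlusSymbol D₀.f r ≠ 0 → 0 ≤ padicValRat 3 (ratPlusSymbol D₀.f r)) →
        kuriharaVanishingOrder W₀ 3 D₀.f = 0 →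
        ¬ (haveI : Fact (Nat.Prime 3) := ⟨Nat.prime_three⟩; Addv W₀ 3) →
        (W₀.HasGoodReductionAtPrime 3 → ¬ (3 : ℤ) ∣ W₀.frobeniusTrace 3) →
        (W₀.HasMultiplicativeReductionAtPrime 3 →
          (haveI : Fact (Nat.Prime 3) := ⟨Nat.prime_three⟩; Ram W₀ 3)) →
        padicValNat 3 W₀.tamagawaProduct ≤ 1 → 3 ∣ W₀.tamagawaProduct →
        (∀ (p : ℕ) (hp : p.Prime), p ^ 2 ∣ N → ¬ 3 ∣ (haveI := Fact.mk hp; (W₀.baseChange ℚ_[p]).localTamagawaNumber ℤ_[p])) →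
        (∀ v : HeightOneSpectrum ℤ, W₀.HasAdditiveReductionAt v → 3 ∣ (W₀.kodairaSymbolAt v).componentGroupOrder →
          ¬ natGenerator v ^ 3 ∣ N) →
        ∃ d : ℕ, kuriharaPartialDeepInfty W₀ 3 D₀.f = d ∧
          kuriharaPartial W₀ 3 D₀.f 0 ≤
            ((padicValNat 3 (Nat.card (AddCommGroup.primaryComponent W₀.sha 3)) + d : ℕ) : ℕ∞) := by
  intro W₀ _ _ htower hfin N _ hN D₀ hopt hdeg hint hord hnA hordinary hram hv h3 hKc hK3
  obtain ⟨q, π, hqN, hLL⟩ := isStabilisedLevelLoweringCongruenceIn_of_drop hRk hCE hV hGV hI W₀ htower hN D₀ hint hnA h3 hKc hK3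
  exact stub_nonAdditive_covered_of_plusSymbolLevelLowersOver hYZ hW20 hSk hmod hGZK hM W₀ htower hfin hN D₀ hopt hdeg
    hint hord hnA hordinary hram hv π q (hN ▸ hqN)
    (plusSymbolLevelLowersOver_three_of_isStabilisedLevelLoweringCongruenceIn W₀ D₀.f q π hLL)

/-- ★¹⁴ᶜ **`stub_nonAdditive` on EVERY depth-`1` row with `3 ∣ ∏ c_ℓ` under the COVERED consumer** (= ★¹⁰ᶜ ∨ ★¹³ᶜ): stub
binders VERBATIM + «ordinary if good» + «(ram) only if `3` is multiplicative» + `v₃(∏c) ≤ 1` + `3 ∣ ∏c` + the two decidable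
guards; THIRTEEN named facts (hYZ PRE-tier). [cite: YanZhu2024MainConjNonCM, Thm. 4.15 (§4.6)] [cite: Skinner2016PacificMC, Thm. C (§1)]
[cite: DarmonDiamondTaylor1995, Thm. 3.15, Thm. 3.1 (e)] [cite: DiamondRibet1997, §4.5 Lemma 4.6] [cite: Ribet1984ICM, Thm. 4.1] -/
theorem stub_nonAdditive_covered_tamagawaDepthOne
    (hRk : ribet1990_levelLowering_gamma0_newform_at_three_additiveDrop)
    (hDR : diamondRibet1997_iharaLemma_at_dividingPrime_three_additive)
    (hCa : carayol1986_cuspCoeff_congr_at_additiveDrop_three)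
    (hCE : colemanEdixhoven1998_heckePolynomial_simpleRoots)
    (hV : vatsal1999_plusSymbol_congruence) (hGV : greenbergVatsal2000_plusSymbol_congruence)
    (hI : ribet1984_iharaLemma)
    (hYZ : YanZhu2026.thm415_padicValRat_bsd_rank_le_one)
    (hW20 : Wuthrich2014.lemma20_surjective_threeAdic_of_semistable)
    (hSk : Skinner2016.thmC_padicValRat_bsd_rank_zero)
    (hmod : hasEntireLFunction_rat) (hGZK : rank_eq_analyticRank_of_analyticRank_le_one)
    (hM : mazur_not_dvd_maninConstant_of_odd) :
    ∀ (W₀ : WeierstrassCurve ℚ) [W₀.IsElliptic] [W₀.IsGloballyMinimal],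
      (∀ n : ℕ, W₀.HasSurjectiveModNGaloisRep (3 ^ n : ℕ)) → Finite W₀.sha →
      ∀ {N : ℕ} [NeZero N], N = W₀.conductorNorm ℤ →
      ∀ (D₀ : ModularParametrizationData W₀ N),
        (∀ z ∈ D₀.L.lattice, ∃ w ∈ periodLattice D₀.f, z = D₀.c * w) →
        (∀ (W₂ : WeierstrassCurve ℚ) [W₂.IsElliptic] (D₂ : ModularParametrizationData W₂ N),
          D₂.f = D₀.f → D₀.modularDegree ≤ D₂.modularDegree) →
        (∀ r : ℚ, ratPlusSymbol D₀.f r ≠ 0 → 0 ≤ padicValRat 3 (ratPlusSymbol D₀.f r)) →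
        kuriharaVanishingOrder W₀ 3 D₀.f = 0 →
        ¬ (haveI : Fact (Nat.Prime 3) := ⟨Nat.prime_three⟩; Addv W₀ 3) →
        (W₀.HasGoodReductionAtPrime 3 → ¬ (3 : ℤ) ∣ W₀.frobeniusTrace 3) →
        (W₀.HasMultiplicativeReductionAtPrime 3 →
          (haveI : Fact (Nat.Prime 3) := ⟨Nat.prime_three⟩; Ram W₀ 3)) →
        padicValNat 3 W₀.tamagawaProduct ≤ 1 → 3 ∣ W₀.tamagawaProduct →
        (∀ v : HeightOneSpectrum ℤ, W₀.HasAdditiveReductionAt v → 3 ∣ (W₀.kodairaSymbolAt v).componentGroupOrder →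
          ¬ natGenerator v ^ 3 ∣ N) →
        (∀ (p : ℕ) (hp : p.Prime), p ^ 2 ∣ N →
          3 ∣ (haveI := Fact.mk hp; (W₀.baseChange ℚ_[p]).localTamagawaNumber ℤ_[p]) → 3 * p ^ 2 < N) →
        ∃ d : ℕ, kuriharaPartialDeepInfty W₀ 3 D₀.f = d ∧
          kuriharaPartial W₀ 3 D₀.f 0 ≤
            ((padicValNat 3 (Nat.card (AddCommGroup.primaryComponent W₀.sha 3)) + d : ℕ) : ℕ∞) := by
  intro W₀ _ _ htower hfin N _ hN D₀ hopt hdeg hint hord hnA hordinary hram hv h3 hK3 hbig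
  by_cases hKc : ∀ (p : ℕ) (hp : p.Prime), p ^ 2 ∣ N →
      ¬ 3 ∣ (haveI := Fact.mk hp; (W₀.baseChange ℚ_[p]).localTamagawaNumber ℤ_[p])
  · exact stub_nonAdditive_covered_tamagawaDepthOne_of_drop hRk hCE hV hGV hI hYZ hW20 hSk hmod hGZK hM W₀ htower hfin hN D₀
      hopt hdeg hint hord hnA hordinary hram hv h3 hKc hK3
  · push Not at hKc
    obtain ⟨ℓ, hℓ, hℓ2N, h3c⟩ := hKc
    exact stub_nonAdditive_covered_tamagawaDepthOne_of_additiveTamagawa hRk hDR hCa hCE hV hGV hYZ hW20 hSk hmod hGZK hM W₀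
      htower hfin hN D₀ hopt hdeg hint hord hnA hordinary hram hv ℓ hℓ hℓ2N h3c (hbig ℓ hℓ hℓ2N h3c) hK3

/-- ★¹⁵ᶜ **`stub_nonAdditive` on EVERY row of TAMAGAWA DEPTH `≤ 1` under the COVERED consumer** — stub binders VERBATIM +
«ordinary if good» + «(ram) only if `3` is multiplicative» + `v₃(∏ c_ℓ) ≤ 1` + the two decidable guards: `3 ∤ ∏c` by gen 0's
`…OffStratumNonAdditiveRows.stub_nonAdditive_covered_of_not_three_dvd_tamagawa`, else ★¹⁴ᶜ. THIRTEEN named facts (hYZ PRE-tier);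
the (ram) twin from refereed print only is `…DepleteTamagawaRowsClass.stub_nonAdditive_ram_tamagawaDepthLeOne`.
[cite: YanZhu2024MainConjNonCM, Thm. 4.15 (§4.6)] [cite: Skinner2016PacificMC, Thm. C (§1)] [cite: Mazur1978, Cor. 4.1]
[cite: Kim2022StructureSelmer, Thm. 1.9 (6), Conj. 1.10] [cite: DarmonDiamondTaylor1995, Thm. 3.15, Thm. 3.1 (e)] -/
theorem stub_nonAdditive_covered_tamagawaDepthLeOne
    (hRk : ribet1990_levelLowering_gamma0_newform_at_three_additiveDrop)
    (hDR : diamondRibet1997_iharaLemma_at_dividingPrime_three_additive)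
    (hCa : carayol1986_cuspCoeff_congr_at_additiveDrop_three)
    (hCE : colemanEdixhoven1998_heckePolynomial_simpleRoots)
    (hV : vatsal1999_plusSymbol_congruence) (hGV : greenbergVatsal2000_plusSymbol_congruence)
    (hI : ribet1984_iharaLemma)
    (hYZ : YanZhu2026.thm415_padicValRat_bsd_rank_le_one)
    (hW20 : Wuthrich2014.lemma20_surjective_threeAdic_of_semistable)
    (hSk : Skinner2016.thmC_padicValRat_bsd_rank_zero)
    (hmod : hasEntireLFunction_rat) (hGZK : rank_eq_analyticRank_of_analyticRank_le_one)
    (hM : mazur_not_dvd_maninConstant_of_odd) :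
    ∀ (W₀ : WeierstrassCurve ℚ) [W₀.IsElliptic] [W₀.IsGloballyMinimal],
      (∀ n : ℕ, W₀.HasSurjectiveModNGaloisRep (3 ^ n : ℕ)) → Finite W₀.sha →
      ∀ {N : ℕ} [NeZero N], N = W₀.conductorNorm ℤ →
      ∀ (D₀ : ModularParametrizationData W₀ N),
        (∀ z ∈ D₀.L.lattice, ∃ w ∈ periodLattice D₀.f, z = D₀.c * w) →
        (∀ (W₂ : WeierstrassCurve ℚ) [W₂.IsElliptic] (D₂ : ModularParametrizationData W₂ N),
          D₂.f = D₀.f → D₀.modularDegree ≤ D₂.modularDegree) →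
        (∀ r : ℚ, ratPlusSymbol D₀.f r ≠ 0 → 0 ≤ padicValRat 3 (ratPlusSymbol D₀.f r)) →
        kuriharaVanishingOrder W₀ 3 D₀.f = 0 →
        ¬ (haveI : Fact (Nat.Prime 3) := ⟨Nat.prime_three⟩; Addv W₀ 3) →
        (W₀.HasGoodReductionAtPrime 3 → ¬ (3 : ℤ) ∣ W₀.frobeniusTrace 3) →
        (W₀.HasMultiplicativeReductionAtPrime 3 →
          (haveI : Fact (Nat.Prime 3) := ⟨Nat.prime_three⟩; Ram W₀ 3)) →
        padicValNat 3 W₀.tamagawaProduct ≤ 1 →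
        (∀ v : HeightOneSpectrum ℤ, W₀.HasAdditiveReductionAt v → 3 ∣ (W₀.kodairaSymbolAt v).componentGroupOrder →
          ¬ natGenerator v ^ 3 ∣ N) →
        (∀ (p : ℕ) (hp : p.Prime), p ^ 2 ∣ N →
          3 ∣ (haveI := Fact.mk hp; (W₀.baseChange ℚ_[p]).localTamagawaNumber ℤ_[p]) → 3 * p ^ 2 < N) →
        ∃ d : ℕ, kuriharaPartialDeepInfty W₀ 3 D₀.f = d ∧
          kuriharaPartial W₀ 3 D₀.f 0 ≤
            ((padicValNat 3 (Nat.card (AddCommGroup.primaryComponent W₀.sha 3)) + d : ℕ) : ℕ∞) := by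
  intro W₀ _ _ htower hfin N _ hN D₀ hopt hdeg hint hord hnA hordinary hram hv hK3 hbig
  by_cases h3 : 3 ∣ W₀.tamagawaProduct
  · exact stub_nonAdditive_covered_tamagawaDepthOne hRk hDR hCa hCE hV hGV hI hYZ hW20 hSk hmod hGZK hM W₀ htower hfin hN D₀
      hopt hdeg hint hord hnA hordinary hram hv h3 hK3 hbig
  · exact stub_nonAdditive_covered_of_not_three_dvd_tamagawa hYZ hW20 hSk hmod hGZK hM W₀ htower hfin hN D₀ hopt hdeg hint
      hord hnA hordinary hram h3

end Covered

end Summit.BirchSwinnertonDyer.BirchSwinnertonDyer.Theorems.KimAtThreeDeepLowerOffStratumLevelLoweringMultiStabDepleteClassCovered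

end
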